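import Literature.Topology.PlanarFoliations.WalkFence
import Literature.Topology.FourManifolds.TautFoliationsNullTransportM
import Literature.Topology.FourManifolds.TautFoliationsFenceVanishing
import HarnessLib

/-!
# Null transport along a closed walk: the tracked leaves return

Topic: Topology / PlanarFoliations, sequel to `WalkFence.lean` and
`TautFoliationsNullTransportM.lean` (transport of null-homotopy along a closed fence in `M`).
The walk fence of a closed walk (`StarData.walkFence`) is in the normal form of the
transport theorem: its initial germ is the height germ of the flow box of the first puncture
(`WalkJunction.start_germ`) and its initial vertical runs on the plaques of that box; so
`IsFenceOn.exists_forall_nullLevel(_base)` apply to it verbatim (closed levels near a null level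
are null). This file adds the **monodromy half** of the transport (Camacho–Lins Neto, Ch. IV §2,
Ch. VII §2: "all the orbits in `R` have trivial holonomy … the holonomy transformation is the
identity"):

* `IsFenceOn.apply_one_eq_of_nullLevel` (**proved**, any foliation): **if the base horizontal
  loop of a fence over the unit interval is null-homotopic in its leaf, the germ path of the
  fence is a loop** — the germ path is the lift of the base loop to the germ covering
  (`Foliation.isCoveringMap_proj`, `IsCoveringMap.eq_liftPath_iff'`), and lifts of loops
  homotopic to a constant rel end points are loops (`IsCoveringMap.liftPath_apply_one_eq_of_homotopicRel`).
* `WalkJunction.eventuallyEq_χ₀_of_sectorGerm_eq`, `WalkJunction.eventuallyEq_χ₀_of_nullLevel`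
  (**proved**): for the walk fence of a closed walk, **if the base level is null then the final
  level conversion `χ` agrees with the initial one `χ₀` near the base level** — so all levels
  near the base level are closed and every tracked planar leaf path returns to its starting point
  on the star vertical (`StarData.walk_returns_of_nullLevel`).

## References

* C. Camacho, A. Lins Neto, *Geometric Theory of Foliations*, Birkhäuser (1985), Ch. IV §2,
  Ch. VII §2 [CamachoLinsNeto1985].
-/

noncomputable section

open Set Filter Function Metric unitInterval
open _root_.Topology
open Literature.Topology.FourManifolds Literature.Topology.FourManifolds.Foliation

/-! ## Null base loops lift to loops of germs -/

namespace Literature.Topology.FourManifolds.Foliation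

variable {B : Type*} [NormedAddCommGroup B] [NormedSpace ℝ B] [LocallyConnectedSpace B] [Nonempty B]
  {M : Type*} [TopologicalSpace M] {F : Foliation B M}
variable {Γ : C(I, F.GermSpace)} {τ₀ ε : ℝ} {Φ : I → ℝ → M}

omit [NormedSpace ℝ B] [LocallyConnectedSpace B] [Nonempty B] in
/-- Equal points of the germ space have equal germ representatives. [folklore] -/
theorem GermSpace.coe_eq_coe_of_eq {d d' : F.GermSpace} (h : d = d') {φ φ' : M → ℝ}
    (hd : d.germ = ↑φ) (hd' : d'.germ = ↑φ') : (↑φ : Germ (𝓝 (ofLeafSpace d.pt)) ℝ) = ↑φ' := by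
  subst h
  rw [← hd, hd']

omit [NormedSpace ℝ B] in
/-- **If the base horizontal loop of a fence is null-homotopic in its leaf, the germ path of the
fence is a loop.** [cite: CamachoLinsNeto1985, Ch. IV §2] -/
theorem IsFenceOn.apply_one_eq_of_nullLevel (hΦ : IsFenceOn F Γ τ₀ ε Φ univ) (hnull : hΦ.NullLevel τ₀) : Γ 1 = Γ 0 := by
  obtain ⟨hτ₀, hcl, hhom⟩ := hnull
  have cov := F.isCoveringMap_proj
  have hpt : ∀ θ, GermSpace.proj (Γ θ) = toLeafSpace (Φ θ τ₀) := fun θ ↦ by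
    rw [hΦ.base θ (mem_univ θ), toLeafSpace_ofLeafSpace]; rfl
  have h₀ : (hΦ.horizLoop τ₀ hτ₀ hcl : C(I, F.LeafSpace)) 0 = GermSpace.proj (Γ 0) := by rw [hpt 0]; rfl
  have h₁ : (Path.refl (toLeafSpace (Φ 0 τ₀) : F.LeafSpace) : C(I, F.LeafSpace)) 0 = GermSpace.proj (Γ 0) := by
    rw [hpt 0]; rfl
  have hlift : Γ = cov.liftPath (hΦ.horizLoop τ₀ hτ₀ hcl : C(I, F.LeafSpace)) (Γ 0) h₀ := by
    rw [cov.eq_liftPath_iff']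
    exact ⟨funext fun θ ↦ hpt θ, rfl⟩
  have hconst : ContinuousMap.const I (Γ 0) =
      cov.liftPath (Path.refl (toLeafSpace (Φ 0 τ₀) : F.LeafSpace) : C(I, F.LeafSpace)) (Γ 0) h₁ := by
    rw [cov.eq_liftPath_iff']
    exact ⟨funext fun _ ↦ hpt 0, rfl⟩
  have hrel : (hΦ.horizLoop τ₀ hτ₀ hcl : C(I, F.LeafSpace)).HomotopicRel
      (Path.refl (toLeafSpace (Φ 0 τ₀) : F.LeafSpace) : C(I, F.LeafSpace)) {0, 1} := hhom
  have hend := cov.liftPath_apply_one_eq_of_homotopicRel hrel (Γ 0) h₀ h₁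
  rw [← hlift, ← hconst] at hend
  exact hend

end Literature.Topology.FourManifolds.Foliation

namespace Literature.Topology.PlanarFoliations

variable {X : Type*} [TopologicalSpace X] [Nonempty X] {F : Foliation ℝ X} {ι : X → ℂ}
variable {B : Type*} [NormedAddCommGroup B] [NormedSpace ℝ B] {M : Type*} [TopologicalSpace M]
  {T : Foliation B M} {g : ℂ → M}

namespace StarData

variable {D : StarData F ι T g} {hι : IsOpenEmbedding ι}

namespace WalkJunction

omit [NormedSpace ℝ B] in
/-- **If the final junction germ of a closed walk equals the initial one, the final level
conversion agrees with the initial one near the base level**: both germs are germs at the prong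
point of `(Λ ∘ χ)⁻¹ ∘ h_{box v}` resp. `h_{box v}`, so `(Λ ∘ χ)⁻¹ = id` near `τ₀`
(`Foliation.eventuallyEq_of_comp_height_eq`), i.e. `χ = Λ⁻¹ = χ₀`. [folklore] -/
theorem eventuallyEq_χ₀_of_sectorGerm_eq (J₀ : D.WalkJunction hι) {χ : ℝ ≃o ℝ} (hχ : χ J₀.τ₀ = 0)
    (h : D.sectorGerm J₀.hv J₀.jin J₀.β 0 χ J₀.τ₀ 0 = J₀.start) : (χ : ℝ → ℝ) =ᶠ[𝓝 J₀.τ₀] J₀.χ₀ := by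
  have hbox := D.box_mem J₀.v (D.mem_P _ J₀.hv)
  -- the base point and its height
  set b : B := (D.box J₀.v (g ((D.star J₀.v J₀.hv).pt J₀.jin (βline J₀.β 0 0, 0)))).1 with hb
  have htarget : (b, D.gateIso J₀.hv χ J₀.τ₀) ∈ (D.box J₀.v).target := by
    rw [T.target_eq _ hbox]; exact mem_univ _
  have hz : (D.box J₀.v).symm (b, D.gateIso J₀.hv χ J₀.τ₀) ∈ (D.box J₀.v).source := (D.box J₀.v).map_target htarget
  have hz2 : (D.box J₀.v ((D.box J₀.v).symm (b, D.gateIso J₀.hv χ J₀.τ₀))).2 = J₀.τ₀ := by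
    rw [(D.box J₀.v).right_inv htarget, gateIso_apply, hχ, levelIso_zero]; rfl
  -- the two germs
  have hgerms : (↑((D.gateIso J₀.hv χ).symm ∘ height (D.box J₀.v)) :
      Germ (𝓝 (ofLeafSpace (D.sectorGerm J₀.hv J₀.jin J₀.β 0 χ J₀.τ₀ 0).pt)) ℝ) = ↑(id ∘ height (D.box J₀.v)) :=
    GermSpace.coe_eq_coe_of_eq h rfl J₀.start_germ
  have hφ := T.eventuallyEq_of_comp_height_eq hbox hz hgerms
  rw [hz2] at hφ
  refine hφ.mono fun r hr ↦ ?_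
  have h2 : χ (χ.symm ((D.levelIso J₀.hv).symm r)) = χ r := congrArg χ hr
  rw [OrderIso.apply_symm_apply] at h2
  exact h2.symm

omit [NormedSpace ℝ B] in
/-- **If the base level of the walk fence of a closed walk is null, the final level conversion
agrees with the initial one near the base level.** [cite: CamachoLinsNeto1985, Ch. VII §2] -/
theorem eventuallyEq_χ₀_of_nullLevel [LocallyConnectedSpace B] [Nonempty B] (J₀ : D.WalkJunction hι) {χ : ℝ ≃o ℝ}
    (hχ : χ J₀.τ₀ = 0) {ε : ℝ} {Γ : Path J₀.start (D.sectorGerm J₀.hv J₀.jin J₀.β 0 χ J₀.τ₀ 0)} {Φ : I → ℝ → M}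
    (hΦ : IsFenceOn T (Γ : C(I, T.GermSpace)) J₀.τ₀ ε Φ univ) (hnull : hΦ.NullLevel J₀.τ₀) :
    (χ : ℝ → ℝ) =ᶠ[𝓝 J₀.τ₀] J₀.χ₀ := by
  have h := hΦ.apply_one_eq_of_nullLevel hnull
  have h' : D.sectorGerm J₀.hv J₀.jin J₀.β 0 χ J₀.τ₀ 0 = J₀.start := Γ.target.symm.trans (h.trans Γ.source)
  exact J₀.eventuallyEq_χ₀_of_sectorGerm_eq hχ h'

end WalkJunction

/-- **If the base loop of the walk fence of a closed walk is null, the final level conversion is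
the initial one near the base level** (`χ = χ₀` on a neighbourhood of `τ₀`). [cite: CamachoLinsNeto1985, Ch. VII §2] -/
theorem walkFence_χ_eq_χ₀_of_null [LocallyConnectedSpace B] [Nonempty B] (ho : F.IsTransverselyOriented)
    (J : ℕ → D.WalkJunction hι) (ℓ : ∀ k, Path (J k).Kout.base (J (k + 1)).Kin.base)
    (hℓ : ∀ k, Continuous (toLeafSpace ∘ ℓ k : I → F.LeafSpace)) {s : ℝ} (hs : s = 1 ∨ s = -1)
    (hturn : ∀ k, (J k).jout = (J k).turn s) {m : ℕ} (hper : J m = J 0)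
    (hnull : ∃ (p : T.LeafSpace) (L : Path p p), (∀ θ, L θ = toLeafSpace (D.walkBase J ℓ m θ)) ∧ L.Homotopic (Path.refl p)) :
    ∃ η > (0 : ℝ), η ≤ (D.walkFence ho hℓ hs hturn m).ε ∧
      ∀ τ ∈ Ioo ((J 0).τ₀ - η) ((J 0).τ₀ + η), (D.walkFence ho hℓ hs hturn m).χ τ = (J 0).χ₀ τ := by
  set W := D.walkFence ho hℓ hs hturn m with hW
  obtain ⟨χ, ε, Γ, Φ, hχ, hε, hΦ, hΦ0, hΦ1, hbase, hχW, hεW⟩ :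
      ∃ (χ : ℝ ≃o ℝ) (ε : ℝ) (Γ : Path (J 0).start (D.sectorGerm (J m).hv (J m).jin (J m).β 0 χ (J 0).τ₀ 0))
        (Φ : I → ℝ → M), χ (J 0).τ₀ = 0 ∧ 0 < ε ∧ IsFenceOn T Γ (J 0).τ₀ ε Φ univ ∧
        (∀ τ ∈ Ioo ((J 0).τ₀ - ε) ((J 0).τ₀ + ε), Φ 0 τ = g ((D.star (J 0).v (J 0).hv).pt (J 0).jin ((J 0).β, (J 0).χ₀ τ))) ∧
        (∀ τ ∈ Ioo ((J 0).τ₀ - ε) ((J 0).τ₀ + ε), Φ 1 τ = g ((D.star (J m).v (J m).hv).pt (J m).jin ((J m).β, χ τ))) ∧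
        (∀ θ, Φ θ (J 0).τ₀ = D.walkBase J ℓ m θ) ∧ χ = W.χ ∧ ε = W.ε :=
    ⟨W.χ, W.ε, W.Γ, W.Φ, W.χ_apply, W.ε_pos, W.isFenceOn, W.Φ_zero, W.Φ_one, W.Φ_base, rfl, rfl⟩
  have hend : D.sectorGerm (J 0).hv (J 0).jin (J 0).β 0 χ (J 0).τ₀ 0 = D.sectorGerm (J m).hv (J m).jin (J m).β 0 χ (J 0).τ₀ 0 := by
    rw [hper]
  rw [hper] at hΦ1
  have hΦ' : IsFenceOn T ((Γ.cast rfl hend : Path _ _) : C(I, T.GermSpace)) (J 0).τ₀ ε Φ univ := hΦ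
  have hτ₀ : (J 0).τ₀ ∈ Ioo ((J 0).τ₀ - ε) ((J 0).τ₀ + ε) := ⟨by linarith, by linarith⟩
  have hcl₀ : Φ 1 (J 0).τ₀ = Φ 0 (J 0).τ₀ := by rw [hΦ1 _ hτ₀, hΦ0 _ hτ₀, hχ, (J 0).χ₀_τ₀]
  have hnl : hΦ'.NullLevel (J 0).τ₀ := by
    obtain ⟨p, L, hL, hLnull⟩ := hnull
    refine ⟨hτ₀, hcl₀, ?_⟩
    exact (Path.homotopic_refl_iff_of_forall_eq (ℓ₁ := L) (ℓ₂ := hΦ'.horizLoop (J 0).τ₀ hτ₀ hcl₀) fun θ ↦ by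
      rw [hL θ, hΦ'.horizLoop_apply hτ₀ hcl₀ θ, hbase θ]).1 hLnull
  obtain ⟨η, hη, hηsub⟩ := IsHomeoGermAt.exists_Ioo_subset_of_mem_nhds ((J 0).eventuallyEq_χ₀_of_nullLevel hχ hΦ' hnl)
  refine ⟨min η ε, lt_min hη hε, hεW ▸ min_le_right η ε, fun τ hτ ↦ ?_⟩
  have hτη : τ ∈ Ioo ((J 0).τ₀ - η) ((J 0).τ₀ + η) := ⟨by linarith [hτ.1, min_le_left η ε], by linarith [hτ.2, min_le_left η ε]⟩
  rw [← hχW]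
  exact hηsub hτη

/-- **Null transport along a closed walk: the tracked leaves return.** For a closed walk turning
to the side `s` whose image loop (the base horizontal `walkBase` of its walk fence) is
null-homotopic in its leaf of `T`, every planar leaf through a point of the star vertical of the
first prong point at a level on the side `s` close to the base level, followed along the walk,
**returns to that point**: there is a path of `X` continuous in the leaf topology, from that
point to itself, whose image is the horizontal of the walk fence at that level.
[cite: CamachoLinsNeto1985, Ch. VII §2] -/
theorem walk_returns_of_nullLevel [LocallyConnectedSpace B] [Nonempty B] (ho : F.IsTransverselyOriented)
    (J : ℕ → D.WalkJunction hι) (ℓ : ∀ k, Path (J k).Kout.base (J (k + 1)).Kin.base)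
    (hℓ : ∀ k, Continuous (toLeafSpace ∘ ℓ k : I → F.LeafSpace)) {s : ℝ} (hs : s = 1 ∨ s = -1)
    (hturn : ∀ k, (J k).jout = (J k).turn s) {m : ℕ} (hper : J m = J 0)
    (hnull : ∃ (p : T.LeafSpace) (L : Path p p), (∀ θ, L θ = toLeafSpace (D.walkBase J ℓ m θ)) ∧ L.Homotopic (Path.refl p)) :
    ∃ η > (0 : ℝ), ∀ τ ∈ Ioo ((J 0).τ₀ - η) ((J 0).τ₀ + η), 0 < s * (τ - (J 0).τ₀) →
      ∃ Ψτ : I → X, Continuous (toLeafSpace ∘ Ψτ : I → F.LeafSpace) ∧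
        Ψτ 0 = (J 0).Kin.T₁ (J 0).χ₀ τ ∧ Ψτ 1 = (J 0).Kin.T₁ (J 0).χ₀ τ ∧
        ι ((J 0).Kin.T₁ (J 0).χ₀ τ) = (D.star (J 0).v (J 0).hv).pt (J 0).jin ((J 0).β, (J 0).χ₀ τ) ∧
        (∀ θ, (D.walkFence ho hℓ hs hturn m).Φ θ τ = g (ι (Ψτ θ))) := by
  set W := D.walkFence ho hℓ hs hturn m with hW
  obtain ⟨χ, ε, Γ, Φ, Ψ, hχ, hε, hΦ, hΦ0, hΦ1, htrack, hbase⟩ :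
      ∃ (χ : ℝ ≃o ℝ) (ε : ℝ) (Γ : Path (J 0).start (D.sectorGerm (J m).hv (J m).jin (J m).β 0 χ (J 0).τ₀ 0))
        (Φ : I → ℝ → M) (Ψ : I → ℝ → X), χ (J 0).τ₀ = 0 ∧ 0 < ε ∧ IsFenceOn T Γ (J 0).τ₀ ε Φ univ ∧
        (∀ τ ∈ Ioo ((J 0).τ₀ - ε) ((J 0).τ₀ + ε), Φ 0 τ = g ((D.star (J 0).v (J 0).hv).pt (J 0).jin ((J 0).β, (J 0).χ₀ τ))) ∧
        (∀ τ ∈ Ioo ((J 0).τ₀ - ε) ((J 0).τ₀ + ε), Φ 1 τ = g ((D.star (J m).v (J m).hv).pt (J m).jin ((J m).β, χ τ))) ∧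
        (∀ τ ∈ Ioo ((J 0).τ₀ - ε) ((J 0).τ₀ + ε), 0 < s * (τ - (J 0).τ₀) →
          (∀ θ, Φ θ τ = g (ι (Ψ θ τ))) ∧ Continuous (toLeafSpace ∘ fun θ ↦ Ψ θ τ : I → F.LeafSpace) ∧
          Ψ 0 τ = (J 0).Kin.T₁ (J 0).χ₀ τ ∧ Ψ 1 τ = (J m).Kin.T₁ χ τ ∧
          ι ((J 0).Kin.T₁ (J 0).χ₀ τ) = (D.star (J 0).v (J 0).hv).pt (J 0).jin ((J 0).β, (J 0).χ₀ τ) ∧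
          ι ((J m).Kin.T₁ χ τ) = (D.star (J m).v (J m).hv).pt (J m).jin ((J m).β, χ τ)) ∧
        (∀ θ, Φ θ (J 0).τ₀ = D.walkBase J ℓ m θ) ∧ Φ = W.Φ :=
    ⟨W.χ, W.ε, W.Γ, W.Φ, W.Ψ, W.χ_apply, W.ε_pos, W.isFenceOn, W.Φ_zero, W.Φ_one, W.track, W.Φ_base, rfl⟩
  obtain ⟨hbase, hΦW⟩ := hbase
  -- re-express the end at `J 0`
  have hend : D.sectorGerm (J 0).hv (J 0).jin (J 0).β 0 χ (J 0).τ₀ 0 = D.sectorGerm (J m).hv (J m).jin (J m).β 0 χ (J 0).τ₀ 0 := by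
    rw [hper]
  rw [hper] at hΦ1 htrack
  have hΦ' : IsFenceOn T ((Γ.cast rfl hend : Path _ _) : C(I, T.GermSpace)) (J 0).τ₀ ε Φ univ := hΦ
  -- the base level is null
  have hτ₀ : (J 0).τ₀ ∈ Ioo ((J 0).τ₀ - ε) ((J 0).τ₀ + ε) := ⟨by linarith, by linarith⟩
  have hcl₀ : Φ 1 (J 0).τ₀ = Φ 0 (J 0).τ₀ := by rw [hΦ1 _ hτ₀, hΦ0 _ hτ₀, hχ, (J 0).χ₀_τ₀]
  have hnl : hΦ'.NullLevel (J 0).τ₀ := by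
    obtain ⟨p, L, hL, hLnull⟩ := hnull
    refine ⟨hτ₀, hcl₀, ?_⟩
    exact (Path.homotopic_refl_iff_of_forall_eq (ℓ₁ := L) (ℓ₂ := hΦ'.horizLoop (J 0).τ₀ hτ₀ hcl₀) fun θ ↦ by
      rw [hL θ, hΦ'.horizLoop_apply hτ₀ hcl₀ θ, hbase θ]).1 hLnull
  -- so `χ = χ₀` near the base level
  obtain ⟨η, hη, hηsub⟩ := IsHomeoGermAt.exists_Ioo_subset_of_mem_nhds ((J 0).eventuallyEq_χ₀_of_nullLevel hχ hΦ' hnl)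
  refine ⟨min η ε, lt_min hη hε, fun τ hτ hsτ ↦ ?_⟩
  have hτη : τ ∈ Ioo ((J 0).τ₀ - η) ((J 0).τ₀ + η) := ⟨by linarith [hτ.1, min_le_left η ε], by linarith [hτ.2, min_le_left η ε]⟩
  have hτε : τ ∈ Ioo ((J 0).τ₀ - ε) ((J 0).τ₀ + ε) := ⟨by linarith [hτ.1, min_le_right η ε], by linarith [hτ.2, min_le_right η ε]⟩
  have heq : χ τ = (J 0).χ₀ τ := hηsub hτη
  obtain ⟨hΦΨ, hΨc, hΨ0, hΨ1, hι0, -⟩ := htrack τ hτε hsτ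
  refine ⟨fun θ ↦ Ψ θ τ, hΨc, hΨ0, ?_, hι0, fun θ ↦ by rw [← hΦW]; exact hΦΨ θ⟩
  show Ψ 1 τ = (J 0).Kin.T₁ (J 0).χ₀ τ
  rw [hΨ1]
  show (J 0).Kin.T₁ χ τ = (J 0).Kin.T₁ (J 0).χ₀ τ
  simp only [ProngBox.T₁, heq]

end StarData

end Literature.Topology.PlanarFoliations
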